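import Summits.HodgeConjecture.HodgeConjecture.Theorems.VHCAbelianSchemesRoadDesignSufficient
import Summits.HodgeConjecture.HodgeConjecture.Theorems.VHCAbelianSchemesRoadDesignNecessary
import Summits.HodgeConjecture.HodgeConjecture.Theorems.VHCAbelianSchemesRoadDiagonalTail
import Summits.HodgeConjecture.HodgeConjecture.Theses.VHCAbelianSchemesRoad
import Literature.Barriers.HodgeConjecture.ExceptionalHodgeClassesHolds
import Literature.AlgebraicGeometry.HodgeTheory.AbelianLowDimensionHodgeConjecture
import HarnessLib

/-!
# Road b02 (`VHCAbelianSchemesRoad`, D-0059) — THE SANDWICH ON THE ROUTE DECLS: the crux `SemiregularSheafRepresentativesTwAtDiag`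
# (item 19787) between the per-variety PINNED DESIGN PROBLEMS and the per-variety DESIGN PROBLEMS MODULO LEFSCHETZ CLASSES

research route conditional on HC_CM; not a corollary; Q11.4-sentence-2 already refuted in dim ≥ 3.
(cell line of seat ab-andre-2: research route, not a corollary; conditional on HC_CM plus one named minimal statement.)

THEOREMS ONLY (no definition, no named fact, no sorry; `HC_CM` occurs nowhere; nothing of the road's research content is claimed).
Seat ab-andre-2 gen 57, PART Z-d: the companion files `VHCAbelianSchemesRoadDesignDefs` (the three per-variety predicates),
`…DesignSufficient` (`PinnedDesignAt ⟹ K-SR♭∃ at (n,p)`, `PinnedHodgeDesignAt ⟹ regime 2 at (n,p)`) and `…DesignNecessary`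
(`regime 2 at (n,p) ⟹ DesignModLefschetzAt`, constant pencil) are door-generic; this CLOSER-type file imports the ROUTE FILE (rev 14) and
states the consequences with the hypotheses / conclusions LITERALLY the route decls of `Theses.VHCAbelianSchemesRoad` (twisted door,
admissibility AdmTw spelled out):

* §1 SUFFICIENT: `twAtDiag_of_forall_pinnedHodgeDesignAt` / `twAtDiag_of_forall_pinnedDesignAt` — the crux decl from the pinned (Hodge)
  design problems at the diagonal cells `(2m, m)`, `m ≥ 2`; stub level: `firstCell_fourfoldMiddleTw_of_pinnedHodgeDesignAt` (cell `(4,2)` =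
  the registered `stub_firstCell_fourfoldMiddleTw` statement), `rung_sixfoldMiddleTw_of_pinnedHodgeDesignAt` (`(6,3)` = `stub_rung_sixfoldMiddleTw`),
  `diagonalTailTw_of_pinnedHodgeDesignAt` (`m ≥ 4` = `stub_diagonalTailTw`); and the LEAF: `hc_av_of_forall_pinnedHodgeDesignAt_tail` —
  `HC_AV` from K-C, the twisted door, Raynaud, André #21/#22 and the pinned Hodge design problems at ANY TAIL of diagonal cells (PART Y: no
  cell is load-bearing for the leaf).
* §2 NECESSARY: `designModLefschetzAt_of_twAtDiag` (the crux decl ⟹ the design problem modulo Lefschetz classes at every diagonal cell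
  `m ≥ 2`), `designModLefschetzAt_of_twAt` (the aside item 19274 ⟹ the same at EVERY `(n, p)`), `designModLefschetzAt_of_lefAt` (the aside
  19779, sheaf door); `exists_twistedDatum_fourfold_of_twAtDiag_of_markman` — THE CRUX DEMANDS A CARRIER on a copy of a Weil-type FOURFOLD
  (Weil's exceptional classes: tree theorem; their algebraicity: Markman's printed Cor. 1.3, hypothesis); KILL SWITCHES `not_twAtDiag_of_not_designModLefschetzAt` / `not_twAt_of_not_designModLefschetzAt`: ONE abelian `2m`-fold
  `X` (`m ≥ 2`) with ONE rational algebraic non-Lefschetz class of codimension `m` admitting no AdmTw-twisted datum with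
  `κ_m ≡ a·w (mod Dᵐ ⊗ ℂ)` on any copy of `X` refutes the crux (and 19274).
* §3 For the road's doors the content of the pinned design is OFF the `θ`-ray (null data: `pinnedDesignAt_twisted_iff_offRay`).
* §4 (appended) NECESSARY, STUB BY STUB: `designModLefschetzAt_of_firstCell_fourfoldMiddleTw` ∕ `…_of_rung_sixfoldMiddleTw` ∕ `…_of_diagonalTailTw`,
  the kill switches for the `(4,2)` stub and the `(6,3)` rung, and `exists_pinned_twistedDatum_sixfold_of_rung_sixfoldMiddleTw` — the rung at a
  Picard-rank-one sixfold demands a PINNED twisted datum `κ₃ = e^*(a·w + c·θ³)` (print: only at secant anchors).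

References: [cite: Bloch1972Semiregularity, Remark (7.5)] [cite: BuchweitzFlenner2003, §5 Thm. 5.1] [cite: vanGeemen1994HodgeAV, §2.4 and
Thm. 4.11] [cite: Andre1996Motifs, §6.3] [cite: Pridham2024Semiregularity, Cor. 2.25 and Rem. 2.27] [cite: Markman2025SecantWeil, Thm. 1.5.1].
-/

noncomputable section

open CategoryTheory CategoryTheory.Limits AlgebraicGeometry Topology

namespace Summit.HodgeConjecture.HodgeConjecture.Ring2.SemiregularRepresentatives

set_option linter.dupNamespace false -- the cell's namespace repeats the summit name, as in every `Ring2*` file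

open Literature.AlgebraicGeometry Literature.AlgebraicGeometry.Motives Literature.AlgebraicGeometry.HodgeTheory
open Literature.AlgebraicTopology.SingularHomology
open Literature.Barriers.HodgeConjecture (divisorClassesSpan)
open Summit.Ventures.HSemireg (ObjClass bfSheafClass)

/-! ## §1 Sufficient: the crux decl, its three registered stubs and the leaf from per-variety pinned design problems -/

/-- **The crux `SemiregularSheafRepresentativesTwAtDiag` (item 19787) from the pinned HODGE design problems at the diagonal cells**: for
every Chern character theory `C` and every `m ≥ 2`, if every complex abelian `2m`-fold `X` with a polarisation class `θ` carries, for each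
rational `(m,m)`-class `w ∉ Dᵐ(X) ⊗ ℂ`, an AdmTw-twisted datum ON `X` with `κ_m = a·w + c·θᵐ` (`a ≠ 0`, sides on the `θ`-ray), then the crux
holds. [cite: Bloch1972Semiregularity, Remark (7.5)] [cite: vanGeemen1994HodgeAV, §2.4 and Thm. 4.11] -/
theorem twAtDiag_of_forall_pinnedHodgeDesignAt
    (h : ∀ (C : ChernCharacterBetti) (m : ℕ), 2 ≤ m →
      PinnedHodgeDesignAt (Literature.AlgebraicGeometry.HodgeTheory.twistedReflexiveClass C
        (fun n X₀ I E => Summit.Ventures.HSemireg.gluableSigmaAdmissible n X₀ I E ∨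
          Literature.AlgebraicGeometry.HodgeTheory.bfSingleAdmissible n X₀ I E)) (2 * m) m) :
    Theses.VHCAbelianSchemesRoad.SemiregularSheafRepresentativesTwAtDiag :=
  fun C m hm ↦ lefAtExceptionalRegimeAt_of_pinnedHodgeDesignAt (h C m hm)

/-- **The crux from the pinned (algebraic) design problems at the diagonal cells** (the form with `w` rational ALGEBRAIC, any; it gives both
regimes). [cite: Bloch1972Semiregularity, Remark (7.5)] [cite: vanGeemen1994HodgeAV, §2.4] -/
theorem twAtDiag_of_forall_pinnedDesignAt
    (h : ∀ (C : ChernCharacterBetti) (m : ℕ), 2 ≤ m →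
      PinnedDesignAt (Literature.AlgebraicGeometry.HodgeTheory.twistedReflexiveClass C
        (fun n X₀ I E => Summit.Ventures.HSemireg.gluableSigmaAdmissible n X₀ I E ∨
          Literature.AlgebraicGeometry.HodgeTheory.bfSingleAdmissible n X₀ I E)) (2 * m) m) :
    Theses.VHCAbelianSchemesRoad.SemiregularSheafRepresentativesTwAtDiag :=
  fun C m hm ↦ lefAtExceptionalRegimeAt_of_pinnedDesignAt (h C m hm)

/-- **Cell `(4, 2)` — the registered stub `stub_firstCell_fourfoldMiddleTw`'s statement — from the pinned Hodge design problem on abelian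
FOURFOLDS in codimension `2`** (the classes off `D² ⊗ ℂ`: on a very general Weil-type fourfold, the Weil classes).
[cite: vanGeemen1994HodgeAV, Thm. 4.11] [cite: Bloch1972Semiregularity, Remark (7.5)] -/
theorem firstCell_fourfoldMiddleTw_of_pinnedHodgeDesignAt
    (h : ∀ C : ChernCharacterBetti,
      PinnedHodgeDesignAt (Literature.AlgebraicGeometry.HodgeTheory.twistedReflexiveClass C
        (fun n X₀ I E => Summit.Ventures.HSemireg.gluableSigmaAdmissible n X₀ I E ∨
          Literature.AlgebraicGeometry.HodgeTheory.bfSingleAdmissible n X₀ I E)) 4 2) :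
    ∀ C : ChernCharacterBetti, LefAtExceptionalRegimeAt (Literature.AlgebraicGeometry.HodgeTheory.twistedReflexiveClass C
      (fun n X₀ I E => Summit.Ventures.HSemireg.gluableSigmaAdmissible n X₀ I E ∨
        Literature.AlgebraicGeometry.HodgeTheory.bfSingleAdmissible n X₀ I E)) 4 2 :=
  fun C ↦ lefAtExceptionalRegimeAt_of_pinnedHodgeDesignAt (h C)

/-- **Cell `(6, 3)` — the registered rung `stub_rung_sixfoldMiddleTw`'s statement (`LefAtExceptionalRegimeSixfoldMiddle`, = cell `(6,3)` by
`Iff.rfl`) — from the pinned Hodge design problem on abelian SIXFOLDS in codimension `3`** (split Weil sixfolds: Markman's secant sheaves are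
the printed candidates AT THE SECANT FIBRE; preprint). [cite: Markman2025SecantWeil, Thm. 1.5.1] [cite: Bloch1972Semiregularity, Remark (7.5)] -/
theorem rung_sixfoldMiddleTw_of_pinnedHodgeDesignAt
    (h : ∀ C : ChernCharacterBetti,
      PinnedHodgeDesignAt (Literature.AlgebraicGeometry.HodgeTheory.twistedReflexiveClass C
        (fun n X₀ I E => Summit.Ventures.HSemireg.gluableSigmaAdmissible n X₀ I E ∨
          Literature.AlgebraicGeometry.HodgeTheory.bfSingleAdmissible n X₀ I E)) 6 3) :
    ∀ C : ChernCharacterBetti, LefAtExceptionalRegimeSixfoldMiddle (Literature.AlgebraicGeometry.HodgeTheory.twistedReflexiveClass C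
      (fun n X₀ I E => Summit.Ventures.HSemireg.gluableSigmaAdmissible n X₀ I E ∨
        Literature.AlgebraicGeometry.HodgeTheory.bfSingleAdmissible n X₀ I E)) :=
  fun C ↦ lefAtExceptionalRegimeSixfoldMiddle_iff_at.2 (lefAtExceptionalRegimeAt_of_pinnedHodgeDesignAt (h C))

/-- **The tail `m ≥ 4` — the registered stub `stub_diagonalTailTw`'s statement — from the pinned Hodge design problems at the cells
`(2m, m)`, `m ≥ 4`** (no print contact at any of them). [cite: Bloch1972Semiregularity, Remark (7.5)] [cite: vanGeemen1994HodgeAV, §2.4] -/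
theorem diagonalTailTw_of_pinnedHodgeDesignAt
    (h : ∀ (C : ChernCharacterBetti) (m : ℕ), 4 ≤ m →
      PinnedHodgeDesignAt (Literature.AlgebraicGeometry.HodgeTheory.twistedReflexiveClass C
        (fun n X₀ I E => Summit.Ventures.HSemireg.gluableSigmaAdmissible n X₀ I E ∨
          Literature.AlgebraicGeometry.HodgeTheory.bfSingleAdmissible n X₀ I E)) (2 * m) m) :
    ∀ (C : ChernCharacterBetti) (m : ℕ), 4 ≤ m →
      LefAtExceptionalRegimeAt (Literature.AlgebraicGeometry.HodgeTheory.twistedReflexiveClass C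
        (fun n X₀ I E => Summit.Ventures.HSemireg.gluableSigmaAdmissible n X₀ I E ∨
          Literature.AlgebraicGeometry.HodgeTheory.bfSingleAdmissible n X₀ I E)) (2 * m) m :=
  fun C m hm ↦ lefAtExceptionalRegimeAt_of_pinnedHodgeDesignAt (h C m hm)

/-- **THE LEAF FROM PER-VARIETY STATEMENTS: `HC_AV` from K-C, the twisted door, Raynaud, André's Lemmes 6.3.1–6.3.3 and the pinned Hodge
design problems at ANY TAIL `m ≥ M₀` of diagonal cells** (through PART Y's `hc_av_of_exceptionalRegimeAt_twisted_diagonal_ge`: no single cell is load-bearing; `HC_CM`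
occurs nowhere). A `B_min`-candidate of the road in PER-VARIETY form: «for all large `m`, every rational `(m,m)`-class off `Dᵐ ⊗ ℂ` on every
polarised abelian `2m`-fold is `a⁻¹(κ_m − c·θᵐ)` for a semiregular AdmTw-twisted datum with sides on the `θ`-ray». [cite: Andre1996Motifs, §6.3]
[cite: Bloch1972Semiregularity, Remark (7.5)] [cite: Pridham2024Semiregularity, Cor. 2.25 and Rem. 2.27] [cite: GortzWedhorn2023, Thm. 27.291] -/
theorem hc_av_of_forall_pinnedHodgeDesignAt_tail (hC : Theses.VHCAbelianSchemesRoad.ChernCharacterOnBetti) (M₀ : ℕ)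
    (h : ∀ (C : ChernCharacterBetti) (m : ℕ), M₀ ≤ m →
      PinnedHodgeDesignAt (Literature.AlgebraicGeometry.HodgeTheory.twistedReflexiveClass C
        (fun n X₀ I E => Summit.Ventures.HSemireg.gluableSigmaAdmissible n X₀ I E ∨
          Literature.AlgebraicGeometry.HodgeTheory.bfSingleAdmissible n X₀ I E)) (2 * m) m)
    (hDoor : Theses.VHCAbelianSchemesRoad.TwistedPerfectDoor) (hR : Theses.VHCAbelianSchemesRoad.RaynaudSectionProjective)
    (h₂₁ : Theses.VHCAbelianSchemesRoad.AndreCMAnchoredPencil) (h₂₂ : Theses.VHCAbelianSchemesRoad.AndreAnchoredPencilsAlgebraic) :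
    Theses.PadicSemiregularLift.HodgeAbelianVarieties :=
  hc_av_of_exceptionalRegimeAt_twisted_diagonal_ge hC (fun _ _ _ _ h ↦ Or.inr h) M₀
    (fun C m hm ↦ lefAtExceptionalRegimeAt_of_pinnedHodgeDesignAt (h C m hm)) hDoor hR h₂₁ h₂₂

/-! ## §2 Necessary: the crux decl (and the aside 19274 / 19779) imply the design problems modulo Lefschetz classes; kill switches -/

/-- **The crux `SemiregularSheafRepresentativesTwAtDiag` implies the design problem modulo Lefschetz classes at every diagonal cell**: for
every `C`, every `m ≥ 2`, every complex abelian `2m`-fold `X` and every rational algebraic class `w ∈ H^{2m}(X(ℂ); ℂ)` off `Dᵐ(X) ⊗ ℂ`, SOME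
COPY of `X` carries an AdmTw-twisted datum with `κ_m = e^*(a·w + z)`, `a ≠ 0`, `z` an algebraic Lefschetz class (constant pencil `X × 𝔸¹`).
[cite: Bloch1972Semiregularity, Remark (7.5)] [cite: vanGeemen1994HodgeAV, §2.4 and Thm. 4.11] -/
theorem designModLefschetzAt_of_twAtDiag (h : Theses.VHCAbelianSchemesRoad.SemiregularSheafRepresentativesTwAtDiag) :
    ∀ (C : ChernCharacterBetti) (m : ℕ), 2 ≤ m →
      DesignModLefschetzAt (Literature.AlgebraicGeometry.HodgeTheory.twistedReflexiveClass C
        (fun n X₀ I E => Summit.Ventures.HSemireg.gluableSigmaAdmissible n X₀ I E ∨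
          Literature.AlgebraicGeometry.HodgeTheory.bfSingleAdmissible n X₀ I E)) (2 * m) m :=
  fun C m hm ↦ designModLefschetzAt_of_lefAtExceptionalRegimeAt (h C m hm)

/-- **The aside item 19274 (`SemiregularSheafRepresentativesTwAt`, K-SR♭∃ over the twisted door, all `(n, p)`) implies the design problem
modulo Lefschetz classes at EVERY `(n, p)`.** [cite: Bloch1972Semiregularity, Remark (7.5)] [cite: vanGeemen1994HodgeAV, §2.4] -/
theorem designModLefschetzAt_of_twAt (h : Theses.VHCAbelianSchemesRoad.SemiregularSheafRepresentativesTwAt)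
    (C : ChernCharacterBetti) (n p : ℕ) :
    DesignModLefschetzAt (Literature.AlgebraicGeometry.HodgeTheory.twistedReflexiveClass C
      (fun n X₀ I E => Summit.Ventures.HSemireg.gluableSigmaAdmissible n X₀ I E ∨
        Literature.AlgebraicGeometry.HodgeTheory.bfSingleAdmissible n X₀ I E)) n p :=
  designModLefschetzAt_of_admissibleRepresentativesLefAt (h C) n p

/-- **The aside item 19779 (`SemiregularSheafRepresentativesLefAt`, the untwisted sheaf door) implies the design problem modulo Lefschetz
classes for the Buchweitz–Flenner sheaf class at every `(n, p)`** — an `I`-semiregular finite locally free sheaf on a copy of `X` with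
`ch_p ≡ a·w (mod Dᵖ ⊗ ℂ)`. [cite: BuchweitzFlenner2003, §5 Thm. 5.1] [cite: Bloch1972Semiregularity, Remark (7.5)] -/
theorem designModLefschetzAt_of_lefAt (h : Theses.VHCAbelianSchemesRoad.SemiregularSheafRepresentativesLefAt)
    (C : ChernCharacterBetti) (n p : ℕ) : DesignModLefschetzAt (bfSheafClass C) n p :=
  designModLefschetzAt_of_admissibleRepresentativesLefAt (h C) n p

/-- **KILL SWITCH for the crux**: ONE Chern character theory `C`, ONE `m ≥ 2` and a failure of the design problem modulo Lefschetz classes at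
`(2m, m)` — i.e. ONE complex abelian `2m`-fold `X` and ONE rational algebraic class `w` of codimension `m` off `Dᵐ(X) ⊗ ℂ` such that NO copy of
`X` carries an AdmTw-twisted datum with `κ_m = e^*(a·w + z)`, `a ≠ 0`, `z` algebraic Lefschetz, sides `(q,q)` — refutes
`SemiregularSheafRepresentativesTwAtDiag`. (Cell by cell: at `(4,2)` a Weil-type fourfold and a Weil class; at `(6,3)` a non-split Weil
sixfold.) [cite: vanGeemen1994HodgeAV, Thm. 4.11] [cite: Bloch1972Semiregularity, Remark (7.5)] -/
theorem not_twAtDiag_of_not_designModLefschetzAt {C : ChernCharacterBetti} {m : ℕ} (hm : 2 ≤ m)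
    (h : ¬ DesignModLefschetzAt (Literature.AlgebraicGeometry.HodgeTheory.twistedReflexiveClass C
      (fun n X₀ I E => Summit.Ventures.HSemireg.gluableSigmaAdmissible n X₀ I E ∨
        Literature.AlgebraicGeometry.HodgeTheory.bfSingleAdmissible n X₀ I E)) (2 * m) m) :
    ¬ Theses.VHCAbelianSchemesRoad.SemiregularSheafRepresentativesTwAtDiag :=
  fun hDiag ↦ h (designModLefschetzAt_of_twAtDiag hDiag C m hm)

/-- **KILL SWITCH for the aside 19274**: a failure of the design problem modulo Lefschetz classes at ANY `(n, p)` refutes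
`SemiregularSheafRepresentativesTwAt`. [cite: Bloch1972Semiregularity, Remark (7.5)] [cite: vanGeemen1994HodgeAV, §2.4] -/
theorem not_twAt_of_not_designModLefschetzAt {C : ChernCharacterBetti} {n p : ℕ}
    (h : ¬ DesignModLefschetzAt (Literature.AlgebraicGeometry.HodgeTheory.twistedReflexiveClass C
      (fun n X₀ I E => Summit.Ventures.HSemireg.gluableSigmaAdmissible n X₀ I E ∨
        Literature.AlgebraicGeometry.HodgeTheory.bfSingleAdmissible n X₀ I E)) n p) :
    ¬ Theses.VHCAbelianSchemesRoad.SemiregularSheafRepresentativesTwAt :=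
  fun hTw ↦ h (designModLefschetzAt_of_twAt hTw C n p)

/-- **THE CRUX DEMANDS A TWISTED CARRIER ON (A COPY OF) A WEIL-TYPE FOURFOLD** — per-variety, pencil-free, modulo Markman's printed
theorem for the algebraicity: Weil's exceptional classes exist unconditionally in the tree (`Weil1977_exceptionalHodgeClasses_holds`: an
abelian fourfold `A` with a rational `(2,2)`-class `w ∉ D²(A) ⊗ ℂ`), they are algebraic by Markman's printed Cor. 1.3 [claim: Markman2025SurveySecant, status: under-review] (hypothesis
`hMark`), so the crux `SemiregularSheafRepresentativesTwAtDiag` forces, for EVERY Chern character theory `C`, an AdmTw-twisted datum on some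
copy `X' ≅ A` with `κ₂ = e^*(a·w + z)`, `a ≠ 0`, `z` an algebraic Lefschetz class — the object no printed construction supplies (Markman's secant
sheaves live on sixfolds). [cite: vanGeemen1994HodgeAV, Thm. 4.11] [cite: Bloch1972Semiregularity, Remark (7.5)] [cite: Markman2025SecantWeil, Cor. 1.6.1] -/
theorem exists_twistedDatum_fourfold_of_twAtDiag_of_markman (hMark : Markman2025_hodgeClasses_algebraic_abelian_dim_le_five)
    (h : Theses.VHCAbelianSchemesRoad.SemiregularSheafRepresentativesTwAtDiag) (C : ChernCharacterBetti) :
    ∃ (A : AbelianVariety ℂ) (w : complexBetti A.X (2 * 2)) (X' : SchemeOver ℂ) (e : X' ≅ A.X) (I : Finset ℕ)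
      (κ : (q : ℕ) → complexBetti X' (2 * q)) (a : ℂ) (z : complexBetti A.X (2 * 2)),
      A.dim = 4 ∧ IsRationalClass w ∧ IsOfHodgeType 4 A.X (2 * 2) 2 2 w ∧ w ∉ divisorClassesSpan A.X 4 2 ∧ 2 ∈ I ∧
      Literature.AlgebraicGeometry.HodgeTheory.twistedReflexiveClass C
        (fun n X₀ I E => Summit.Ventures.HSemireg.gluableSigmaAdmissible n X₀ I E ∨
          Literature.AlgebraicGeometry.HodgeTheory.bfSingleAdmissible n X₀ I E) 4 X' I κ ∧
      a ≠ 0 ∧ z ∈ algebraicClasses A.X 2 ∧ z ∈ divisorClassesSpan A.X 4 2 ∧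
      κ 2 = complexBetti.map e.hom (2 * 2) (a • w + z) ∧ ∀ q ∈ I, IsOfHodgeType 4 X' (2 * q) q q (κ q) := by
  obtain ⟨A, hA, hAX, w, hwQ, hwH, hwD⟩ := Literature.Barriers.HodgeConjecture.Weil1977_exceptionalHodgeClasses_holds.fourfold
  have hAX' : IsSmoothProjective A.dim A.X := by rw [hA]; exact hAX
  have hwH' : IsOfHodgeType A.dim A.X (2 * 2) 2 2 w := by rw [hA]; exact hwH
  have hwalg : w ∈ algebraicClasses A.X 2 := hMark A (by omega) hAX' 2 w hwQ hwH'
  obtain ⟨X', e, I, κ, a, z, hpI, h𝒪, ha, hzalg, hzD, hκp, hκH⟩ :=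
    designModLefschetzAt_of_twAtDiag h C 2 le_rfl A.X ⟨A, hA, ⟨Iso.refl _⟩⟩ w hwQ hwalg hwD
  exact ⟨A, w, X', e, I, κ, a, z, hA, hwQ, hwH, hwD, hpI, h𝒪, ha, hzalg, hzD, hκp, hκH⟩

/-- **The sandwich at one cell, on the route's door**: `PinnedHodgeDesignAt ⟹ cell (2m, m) ⟹ DesignModLefschetzAt` — both per-variety, the
cell in between. [cite: Bloch1972Semiregularity, Remark (7.5)] [cite: vanGeemen1994HodgeAV, §2.4 and Thm. 4.11] -/
theorem sandwich_twisted (C : ChernCharacterBetti) (n p : ℕ) :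
    (PinnedHodgeDesignAt (Literature.AlgebraicGeometry.HodgeTheory.twistedReflexiveClass C
        (fun n X₀ I E => Summit.Ventures.HSemireg.gluableSigmaAdmissible n X₀ I E ∨
          Literature.AlgebraicGeometry.HodgeTheory.bfSingleAdmissible n X₀ I E)) n p →
      LefAtExceptionalRegimeAt (Literature.AlgebraicGeometry.HodgeTheory.twistedReflexiveClass C
        (fun n X₀ I E => Summit.Ventures.HSemireg.gluableSigmaAdmissible n X₀ I E ∨
          Literature.AlgebraicGeometry.HodgeTheory.bfSingleAdmissible n X₀ I E)) n p) ∧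
    (LefAtExceptionalRegimeAt (Literature.AlgebraicGeometry.HodgeTheory.twistedReflexiveClass C
        (fun n X₀ I E => Summit.Ventures.HSemireg.gluableSigmaAdmissible n X₀ I E ∨
          Literature.AlgebraicGeometry.HodgeTheory.bfSingleAdmissible n X₀ I E)) n p →
      DesignModLefschetzAt (Literature.AlgebraicGeometry.HodgeTheory.twistedReflexiveClass C
        (fun n X₀ I E => Summit.Ventures.HSemireg.gluableSigmaAdmissible n X₀ I E ∨
          Literature.AlgebraicGeometry.HodgeTheory.bfSingleAdmissible n X₀ I E)) n p) :=
  ⟨lefAtExceptionalRegimeAt_of_pinnedHodgeDesignAt, designModLefschetzAt_of_lefAtExceptionalRegimeAt⟩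

/-! ## §3 The road's door has null data: the pinned design problem is its off-ray part -/

/-- **For the road's twisted door the pinned design problem is its OFF-RAY part** (the door has null data — the zero sheaf with `B₀ = 0`,
PART V `hasNullDatum_twistedReflexiveClass` — so classes on `ℂ·θᵖ` are served by the null datum). [cite: vanGeemen1994HodgeAV, §2.4 and Thm. 4.11]
[cite: Fulton1998, Example 3.2.3] -/
theorem pinnedDesignAt_twisted_iff_offRay (C : ChernCharacterBetti) (n p : ℕ) :
    PinnedDesignAt (Literature.AlgebraicGeometry.HodgeTheory.twistedReflexiveClass C
        (fun n X₀ I E => Summit.Ventures.HSemireg.gluableSigmaAdmissible n X₀ I E ∨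
          Literature.AlgebraicGeometry.HodgeTheory.bfSingleAdmissible n X₀ I E)) n p ↔
      ∀ (X : SchemeOver ℂ), (∃ A : AbelianVariety ℂ, A.dim = n ∧ Nonempty (A.X ≅ X)) →
        ∀ (θ : complexBetti X 2), IsPolarizationClass n X θ →
        ∀ (w : complexBetti X (2 * p)), IsRationalClass w → w ∈ algebraicClasses X p → w ∉ ℂ ∙ cupPowTwo θ p →
          ∃ (I : Finset ℕ) (κ : (q : ℕ) → complexBetti X (2 * q)) (a : ℂ) (c : ℕ → ℂ),
            p ∈ I ∧ Literature.AlgebraicGeometry.HodgeTheory.twistedReflexiveClass C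
              (fun n X₀ I E => Summit.Ventures.HSemireg.gluableSigmaAdmissible n X₀ I E ∨
                Literature.AlgebraicGeometry.HodgeTheory.bfSingleAdmissible n X₀ I E) n X I κ ∧
            a ≠ 0 ∧ κ p = a • w + c p • cupPowTwo θ p ∧ ∀ q ∈ I, q ≠ p → κ q = c q • cupPowTwo θ q :=
  pinnedDesignAt_iff_offRay_of_hasNullDatum (hasNullDatum_twistedReflexiveClass C _ (fun _ _ _ _ h ↦ Or.inr h))

/-! ## §4 Necessary, STUB BY STUB: each registered stub of 19787 implies the design problem modulo Lefschetz classes at its cells;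
## the (6,3) rung at a Picard-rank-one sixfold demands a PINNED datum (ab-andre-2 gen 57, appended) -/

/-- **The `(4,2)` stub `stub_firstCell_fourfoldMiddleTw` implies the design problem modulo Lefschetz classes on abelian FOURFOLDS in
codimension `2`** (a twisted datum on a copy of EVERY abelian fourfold with an algebraic class off `D² ⊗ ℂ`). [cite: vanGeemen1994HodgeAV, Thm. 4.11]
[cite: Bloch1972Semiregularity, Remark (7.5)] -/
theorem designModLefschetzAt_of_firstCell_fourfoldMiddleTw
    (h : ∀ C : ChernCharacterBetti, LefAtExceptionalRegimeAt (Literature.AlgebraicGeometry.HodgeTheory.twistedReflexiveClass C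
      (fun n X₀ I E => Summit.Ventures.HSemireg.gluableSigmaAdmissible n X₀ I E ∨
        Literature.AlgebraicGeometry.HodgeTheory.bfSingleAdmissible n X₀ I E)) 4 2) (C : ChernCharacterBetti) :
    DesignModLefschetzAt (Literature.AlgebraicGeometry.HodgeTheory.twistedReflexiveClass C
      (fun n X₀ I E => Summit.Ventures.HSemireg.gluableSigmaAdmissible n X₀ I E ∨
        Literature.AlgebraicGeometry.HodgeTheory.bfSingleAdmissible n X₀ I E)) 4 2 :=
  designModLefschetzAt_of_lefAtExceptionalRegimeAt (h C)

/-- **The `(6,3)` rung `stub_rung_sixfoldMiddleTw` implies the design problem modulo Lefschetz classes on abelian SIXFOLDS in codimension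
`3`**: a twisted datum on a copy of EVERY abelian sixfold carrying an algebraic class off `D³ ⊗ ℂ` — every very general SPLIT Weil sixfold
included (its Weil classes are algebraic in print, Markman Thm. 1.2; print supplies a semiregular carrier AT THE SECANT ANCHOR `X × X̂`
only, Thm. 1.4.1, the other members getting algebraicity by flat transport), and every non-split one. [cite: Markman2025SecantWeil, Thm. 1.4.1 and Thm. 1.5.1]
[cite: Bloch1972Semiregularity, Remark (7.5)] -/
theorem designModLefschetzAt_of_rung_sixfoldMiddleTw
    (h : ∀ C : ChernCharacterBetti, LefAtExceptionalRegimeSixfoldMiddle (Literature.AlgebraicGeometry.HodgeTheory.twistedReflexiveClass C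
      (fun n X₀ I E => Summit.Ventures.HSemireg.gluableSigmaAdmissible n X₀ I E ∨
        Literature.AlgebraicGeometry.HodgeTheory.bfSingleAdmissible n X₀ I E))) (C : ChernCharacterBetti) :
    DesignModLefschetzAt (Literature.AlgebraicGeometry.HodgeTheory.twistedReflexiveClass C
      (fun n X₀ I E => Summit.Ventures.HSemireg.gluableSigmaAdmissible n X₀ I E ∨
        Literature.AlgebraicGeometry.HodgeTheory.bfSingleAdmissible n X₀ I E)) 6 3 :=
  designModLefschetzAt_of_lefAtExceptionalRegimeAt (lefAtExceptionalRegimeSixfoldMiddle_iff_at.1 (h C))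

/-- **The tail stub `stub_diagonalTailTw` implies the design problem modulo Lefschetz classes at every cell `(2m, m)`, `m ≥ 4`.**
[cite: Bloch1972Semiregularity, Remark (7.5)] [cite: vanGeemen1994HodgeAV, §2.4] -/
theorem designModLefschetzAt_of_diagonalTailTw
    (h : ∀ (C : ChernCharacterBetti) (m : ℕ), 4 ≤ m →
      LefAtExceptionalRegimeAt (Literature.AlgebraicGeometry.HodgeTheory.twistedReflexiveClass C
        (fun n X₀ I E => Summit.Ventures.HSemireg.gluableSigmaAdmissible n X₀ I E ∨
          Literature.AlgebraicGeometry.HodgeTheory.bfSingleAdmissible n X₀ I E)) (2 * m) m)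
    (C : ChernCharacterBetti) (m : ℕ) (hm : 4 ≤ m) :
    DesignModLefschetzAt (Literature.AlgebraicGeometry.HodgeTheory.twistedReflexiveClass C
      (fun n X₀ I E => Summit.Ventures.HSemireg.gluableSigmaAdmissible n X₀ I E ∨
        Literature.AlgebraicGeometry.HodgeTheory.bfSingleAdmissible n X₀ I E)) (2 * m) m :=
  designModLefschetzAt_of_lefAtExceptionalRegimeAt (h C m hm)

/-- **KILL SWITCH for the `(6,3)` rung**: ONE Chern character theory, ONE abelian sixfold and ONE rational algebraic `(3,3)`-class off
`D³ ⊗ ℂ` admitting no AdmTw-twisted datum `κ₃ ≡ a·w (mod D³ ⊗ ℂ)`, `a ≠ 0`, on any copy refutes `stub_rung_sixfoldMiddleTw` (the line's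
rung is then dead; the crux's repair slides the window). [cite: Bloch1972Semiregularity, Remark (7.5)] [cite: vanGeemen1994HodgeAV, Thm. 4.11] -/
theorem not_rung_sixfoldMiddleTw_of_not_designModLefschetzAt {C : ChernCharacterBetti}
    (h : ¬ DesignModLefschetzAt (Literature.AlgebraicGeometry.HodgeTheory.twistedReflexiveClass C
      (fun n X₀ I E => Summit.Ventures.HSemireg.gluableSigmaAdmissible n X₀ I E ∨
        Literature.AlgebraicGeometry.HodgeTheory.bfSingleAdmissible n X₀ I E)) 6 3) :
    ¬ ∀ C : ChernCharacterBetti, LefAtExceptionalRegimeSixfoldMiddle (Literature.AlgebraicGeometry.HodgeTheory.twistedReflexiveClass C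
      (fun n X₀ I E => Summit.Ventures.HSemireg.gluableSigmaAdmissible n X₀ I E ∨
        Literature.AlgebraicGeometry.HodgeTheory.bfSingleAdmissible n X₀ I E)) :=
  fun hrung ↦ h (designModLefschetzAt_of_rung_sixfoldMiddleTw hrung C)

/-- **KILL SWITCH for the `(4,2)` stub.** [cite: Bloch1972Semiregularity, Remark (7.5)] [cite: vanGeemen1994HodgeAV, Thm. 4.11] -/
theorem not_firstCell_fourfoldMiddleTw_of_not_designModLefschetzAt {C : ChernCharacterBetti}
    (h : ¬ DesignModLefschetzAt (Literature.AlgebraicGeometry.HodgeTheory.twistedReflexiveClass C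
      (fun n X₀ I E => Summit.Ventures.HSemireg.gluableSigmaAdmissible n X₀ I E ∨
        Literature.AlgebraicGeometry.HodgeTheory.bfSingleAdmissible n X₀ I E)) 4 2) :
    ¬ ∀ C : ChernCharacterBetti, LefAtExceptionalRegimeAt (Literature.AlgebraicGeometry.HodgeTheory.twistedReflexiveClass C
      (fun n X₀ I E => Summit.Ventures.HSemireg.gluableSigmaAdmissible n X₀ I E ∨
        Literature.AlgebraicGeometry.HodgeTheory.bfSingleAdmissible n X₀ I E)) 4 2 :=
  fun hcell ↦ h (designModLefschetzAt_of_firstCell_fourfoldMiddleTw hcell C)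

/-- **THE `(6,3)` RUNG AT A PICARD-RANK-ONE SIXFOLD DEMANDS A PINNED TWISTED DATUM** — the rung's per-variety residue in print terms: for
EVERY complex abelian sixfold `X` with `B¹(X) = ℚ·θ` in Hodge form (e.g. a very general member of any Weil-type component, split or not,
van Geemen Thm. 4.11) and every rational ALGEBRAIC class `w ∈ H⁶(X(ℂ); ℂ)` off the ray `ℂ·θ³` (a Weil class, where algebraic), the rung
forces, for every `C`, an AdmTw-twisted datum `(E•, B₀)` on some copy `e : X' ≅ X` with `(exp B₀ · ch E•)_3 = e^*(a·w + c·θ³)`, `a ≠ 0`,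
sides `(q,q)`. Print has such a datum only for `X` a secant ANCHOR (Markman Thm. 1.4.1). [cite: vanGeemen1994HodgeAV, Thm. 4.11]
[cite: Markman2025SecantWeil, Thm. 1.4.1] [cite: Bloch1972Semiregularity, Remark (7.5)] -/
theorem exists_pinned_twistedDatum_sixfold_of_rung_sixfoldMiddleTw
    (h : ∀ C : ChernCharacterBetti, LefAtExceptionalRegimeSixfoldMiddle (Literature.AlgebraicGeometry.HodgeTheory.twistedReflexiveClass C
      (fun n X₀ I E => Summit.Ventures.HSemireg.gluableSigmaAdmissible n X₀ I E ∨
        Literature.AlgebraicGeometry.HodgeTheory.bfSingleAdmissible n X₀ I E))) (C : ChernCharacterBetti)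
    (X : SchemeOver ℂ) (hX : ∃ A : AbelianVariety ℂ, A.dim = 6 ∧ Nonempty (A.X ≅ X)) (θ : complexBetti X 2)
    (hpic : ∀ b : complexBetti X 2, IsRationalClass b → IsOfHodgeType 6 X 2 1 1 b → b ∈ ℂ ∙ θ)
    (w : complexBetti X (2 * 3)) (hwQ : IsRationalClass w) (hwalg : w ∈ algebraicClasses X 3) (hw : w ∉ ℂ ∙ cupPowTwo θ 3) :
    ∃ (X' : SchemeOver ℂ) (e : X' ≅ X) (I : Finset ℕ) (κ : (q : ℕ) → complexBetti X' (2 * q)) (a c : ℂ),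
      3 ∈ I ∧ Literature.AlgebraicGeometry.HodgeTheory.twistedReflexiveClass C
        (fun n X₀ I E => Summit.Ventures.HSemireg.gluableSigmaAdmissible n X₀ I E ∨
          Literature.AlgebraicGeometry.HodgeTheory.bfSingleAdmissible n X₀ I E) 6 X' I κ ∧
      a ≠ 0 ∧ κ 3 = complexBetti.map e.hom (2 * 3) (a • w + c • cupPowTwo θ 3) ∧
      ∀ q ∈ I, IsOfHodgeType 6 X' (2 * q) q q (κ q) :=
  exists_pinned_of_designModLefschetzAt_of_picardRankOne (designModLefschetzAt_of_rung_sixfoldMiddleTw h C) X hX θ hpic w hwQ hwalg hw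

end Summit.HodgeConjecture.HodgeConjecture.Ring2.SemiregularRepresentatives

end
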